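import Summits.QuantumFields.YangMills.Theorems.RenyiTelescopeTelescopedCrux

/-!
# Route `RenyiTelescope` — re-glue item `HistoryTailOfRenyiTelescopeR` (stmt-QuantumFields-27545): THE TELESCOPED REPAIRED CRUX
# (support file; width seat `ym-line-sfw-p2-w3` g23 for planner seat `ym-r3-idea-2` g3; registered stub `stub_telescopedCruxR` of the
# re-glue skeleton v8)

THE STEP.  The REPAIRED crux `CutoffRenyiLR` (stmt-QuantumFields-27544) is a ONE-STEP conditional Rényi comparison of consecutive cut-offs
with exponent `R₀(q−1)p⁴L^(3F.m)(γ²/L^(2J) + 1/L^(4J))` and a free Hölder order `1 < q ≤ Q·L^J` (the old `CutoffRenyiL`, stmt-QuantumFields-27137,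
had `L^(−4J)` and orders up to `Q·L^(2J)`; it is predicted false as typed by the one-loop `O(g²a)` coupling renormalisation in `d = 3`).
This file runs the repaired crux up the cut-offs of a refined family `F.refine d` (coupling `γ_d = γL^(−d)`) with the GEOMETRIC ORDERS
`q_J = κ·(3/2)^J` (`κ ≤ Q`, so `q_J ≤ Q·L^J` because `3/2 ≤ L`) and proves (`stub_telescopedCruxR`): if `κ(3/2)^(J₀) ≥ 6` (so every `q_J > 1`
and the order budget `Σ_(J ≥ J₀) 1/q_J ≤ 3/(κ(3/2)^(J₀)) ≤ 1/2` closes) and the interior events have Gibbs mass `≥ 1/2` at every cut-off in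
`[J₀, J]`, then the unit-event mass at cut-off `J` is at most
  `exp((4/3)·R₀·κ·p(g_d)⁴·L^(3(m+d))·(γ_d²(3/2)^(J₀)/L^(2J₀) + (3/2)^(J₀)/L^(4J₀))) · (u_(J₀)/P_(J₀))^(1/2)`
— the exponent being the geometric sum of the one-step exponents `R₀(q_J − 1)p⁴L^(3(m+d))(γ_d²/L^(2J) + 1/L^(4J))`, summed with the ratios
`(3/2)/L² ≤ 1/4`, `(3/2)/L⁴ ≤ 1/4` (`L ≥ 3`: `T3Family.hL = Odd L ∧ 1 < L`).  Ingredients: the repaired crux (hypothesis), the conditional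
telescope (`stub_conditionalTelescope`, landed p622611; taken as a hypothesis), `geom_sum_quarter` (landed, p624262), the order budget
`order_budgetR` and the exponent budget `exponent_budgetR` below, measurability of the unit-plaquette event, `Gibbs ≤ 1`.
`R₀` is replaced by `max R₀ 0 ≥ 0` (the crux's bound only weakens).

WHAT THIS IS NOT: the repaired crux `CutoffRenyiLR` is a HYPOTHESIS here and stays open; choosing `J₀ = J₀(d)`, `κ`, and closing the interior
masses `≥ 1/2` is the registered stub `stub_glueRestR` (with the landed abstract bootstrap / interior complement and the arithmetic closure
`stub_arithClosureR`); nothing here bears on the Yang–Mills mass gap and the rung R3 (`YM3TorusSU2`) is NOT proved.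

References: T. Bałaban, CMP 102 (1985) 255–275 [Balaban1985UV3] ((7) p.257, (71) p.273); C. King, CMP 103 (1986) 323–349 [King1986]
(Thm 3.4 (3.9): the run-by-run telescope); G. D. Moore, Nucl. Phys. B523 (1998) 569 [arXiv:hep-lat/9709053] (why the exponent is `L^(−2J)`).
-/

noncomputable section

open MeasureTheory
open Literature.MathematicalPhysics.QuantumFieldTheory.Balaban1983to89
open Literature.MathematicalPhysics.QuantumFieldTheory.Balaban1983to89.T3ContinuumYM3Torus
open Literature.MathematicalPhysics.QuantumFieldTheory.Balaban1983to89.T3UnitScaleTilt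
open Literature.MathematicalPhysics.QuantumFieldTheory.Balaban1983to89.T3UnitLawDensityEML
open Literature.MathematicalPhysics.QuantumFieldTheory.Balaban1983to89.T3InteriorExcision

namespace Summit.QuantumFields.YangMills.Theorems.RenyiTelescope

/-! ## §1 Geometric sums for the orders `q_J = κ(3/2)^J` -/

/-- `Σ_(i<n) (2/3)^i ≤ 3`. [folklore] -/
theorem geom_sum_two_thirds (n : ℕ) : ∑ i ∈ Finset.range n, ((2 : ℝ) / 3) ^ i ≤ 3 := by
  have h0 : (0 : ℝ) ≤ 2 / 3 := by norm_num
  have h1 : (2 : ℝ) / 3 < 1 := by norm_num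
  calc ∑ i ∈ Finset.range n, ((2 : ℝ) / 3) ^ i ≤ ∑' i, ((2 : ℝ) / 3) ^ i :=
        (summable_geometric_of_lt_one h0 h1).sum_le_tsum (Finset.range n) fun i _ => pow_nonneg h0 i
    _ = (1 - 2 / 3)⁻¹ := tsum_geometric_of_lt_one h0 h1
    _ ≤ 3 := by norm_num

/-- THE ORDER BUDGET (repaired orders): with `q_J = κ(3/2)^J` and `κ(3/2)^(J₀) ≥ 6`, `Σ_(i<n) 1/q_(J₀+i) ≤ 1/2`. [folklore] -/
theorem order_budgetR {κ : ℝ} (hκ : 0 < κ) {J₀ : ℕ} (h6 : 6 ≤ κ * (3 / 2 : ℝ) ^ J₀) (n : ℕ) :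
    ∑ i ∈ Finset.range n, 1 / (κ * (3 / 2 : ℝ) ^ (J₀ + i)) ≤ 1 / 2 := by
  have hterm : ∀ i : ℕ, 1 / (κ * (3 / 2 : ℝ) ^ (J₀ + i)) = 1 / (κ * (3 / 2 : ℝ) ^ J₀) * ((2 : ℝ) / 3) ^ i := by
    intro i
    have e : ((2 : ℝ) / 3) ^ i = 1 / (3 / 2 : ℝ) ^ i := by
      rw [one_div, ← inv_pow]
      norm_num
    rw [e, pow_add, ← mul_assoc, one_div_mul_one_div]
  calc ∑ i ∈ Finset.range n, 1 / (κ * (3 / 2 : ℝ) ^ (J₀ + i))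
      = ∑ i ∈ Finset.range n, 1 / (κ * (3 / 2 : ℝ) ^ J₀) * ((2 : ℝ) / 3) ^ i := Finset.sum_congr rfl fun i _ => hterm i
    _ = 1 / (κ * (3 / 2 : ℝ) ^ J₀) * ∑ i ∈ Finset.range n, ((2 : ℝ) / 3) ^ i := by rw [Finset.mul_sum]
    _ ≤ 1 / (κ * (3 / 2 : ℝ) ^ J₀) * 3 := mul_le_mul_of_nonneg_left (geom_sum_two_thirds n) (by positivity)
    _ ≤ 1 / 6 * 3 := by
        refine mul_le_mul_of_nonneg_right ?_ (by norm_num)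
        exact one_div_le_one_div_of_le (by norm_num) h6
    _ = 1 / 2 := by norm_num

/-- THE RATIO STEP: for `L ≥ 3` and `k ≥ 2`, `(3/2)^(J₀+i)/L^(k(J₀+i)) ≤ (3/2)^(J₀)/L^(kJ₀) · (1/4)^i` (`(3/2)/L^k ≤ 1/6 ≤ 1/4`). [folklore] -/
theorem ratio_pow_step {L : ℝ} (hL : 3 ≤ L) {k : ℕ} (hk : 2 ≤ k) (J₀ i : ℕ) :
    (3 / 2 : ℝ) ^ (J₀ + i) / L ^ (k * (J₀ + i)) ≤ (3 / 2 : ℝ) ^ J₀ / L ^ (k * J₀) * (1 / 4 : ℝ) ^ i := by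
  have hL0 : 0 < L := by linarith
  have hLk : 6 ≤ L ^ k := by
    calc (6 : ℝ) ≤ 3 ^ 2 := by norm_num
      _ ≤ L ^ 2 := pow_le_pow_left₀ (by norm_num) hL 2
      _ ≤ L ^ k := pow_le_pow_right₀ (by linarith) hk
  have hr : (3 / 2 : ℝ) / L ^ k ≤ 1 / 4 := by
    rw [div_le_iff₀ (by positivity)]
    linarith
  have e : (3 / 2 : ℝ) ^ (J₀ + i) / L ^ (k * (J₀ + i)) = (3 / 2 : ℝ) ^ J₀ / L ^ (k * J₀) * ((3 / 2 : ℝ) / L ^ k) ^ i := by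
    rw [div_pow (3 / 2 : ℝ) (L ^ k) i, ← pow_mul, mul_add, pow_add, pow_add]
    ring
  rw [e]
  exact mul_le_mul_of_nonneg_left (pow_le_pow_left₀ (by positivity) hr i) (by positivity)

/-- THE EXPONENT BUDGET (repaired exponent): for `R, W, G ≥ 0`, `κ > 0`, `L ≥ 3`,
`Σ_(i<n) R(κ(3/2)^(J₀+i) − 1)·W·(G/L^(2(J₀+i)) + 1/L^(4(J₀+i))) ≤ (4/3)RκW·(G(3/2)^(J₀)/L^(2J₀) + (3/2)^(J₀)/L^(4J₀))`. [folklore] -/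
theorem exponent_budgetR {L κ R W G : ℝ} (hL : 3 ≤ L) (hκ : 0 < κ) (hR : 0 ≤ R) (hW : 0 ≤ W) (hG : 0 ≤ G) (J₀ n : ℕ) :
    ∑ i ∈ Finset.range n, R * (κ * (3 / 2 : ℝ) ^ (J₀ + i) - 1) * W * (G / L ^ (2 * (J₀ + i)) + 1 / L ^ (4 * (J₀ + i))) ≤
      4 / 3 * R * κ * W * (G * (3 / 2 : ℝ) ^ J₀ / L ^ (2 * J₀) + (3 / 2 : ℝ) ^ J₀ / L ^ (4 * J₀)) := by
  have hL0 : 0 < L := by linarith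
  set S : ℝ := G * (3 / 2 : ℝ) ^ J₀ / L ^ (2 * J₀) + (3 / 2 : ℝ) ^ J₀ / L ^ (4 * J₀) with hS
  have hS0 : 0 ≤ S := by positivity
  have hterm : ∀ i : ℕ, R * (κ * (3 / 2 : ℝ) ^ (J₀ + i) - 1) * W * (G / L ^ (2 * (J₀ + i)) + 1 / L ^ (4 * (J₀ + i))) ≤
      R * κ * W * S * (1 / 4 : ℝ) ^ i := by
    intro i
    have h1 : R * (κ * (3 / 2 : ℝ) ^ (J₀ + i) - 1) * W * (G / L ^ (2 * (J₀ + i)) + 1 / L ^ (4 * (J₀ + i))) ≤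
        R * (κ * (3 / 2 : ℝ) ^ (J₀ + i)) * W * (G / L ^ (2 * (J₀ + i)) + 1 / L ^ (4 * (J₀ + i))) := by
      refine mul_le_mul_of_nonneg_right (mul_le_mul_of_nonneg_right ?_ hW) (by positivity)
      exact mul_le_mul_of_nonneg_left (by linarith) hR
    have h2 : (3 / 2 : ℝ) ^ (J₀ + i) * (G / L ^ (2 * (J₀ + i)) + 1 / L ^ (4 * (J₀ + i))) ≤ S * (1 / 4 : ℝ) ^ i := by
      have e1 : (3 / 2 : ℝ) ^ (J₀ + i) * (G / L ^ (2 * (J₀ + i)) + 1 / L ^ (4 * (J₀ + i))) =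
          G * ((3 / 2 : ℝ) ^ (J₀ + i) / L ^ (2 * (J₀ + i))) + (3 / 2 : ℝ) ^ (J₀ + i) / L ^ (4 * (J₀ + i)) := by ring
      have e2 : S * (1 / 4 : ℝ) ^ i = G * ((3 / 2 : ℝ) ^ J₀ / L ^ (2 * J₀) * (1 / 4 : ℝ) ^ i) +
          (3 / 2 : ℝ) ^ J₀ / L ^ (4 * J₀) * (1 / 4 : ℝ) ^ i := by rw [hS]; ring
      rw [e1, e2]
      exact add_le_add (mul_le_mul_of_nonneg_left (ratio_pow_step hL (le_refl 2) J₀ i) hG)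
        (ratio_pow_step hL (by norm_num : 2 ≤ 4) J₀ i)
    calc R * (κ * (3 / 2 : ℝ) ^ (J₀ + i) - 1) * W * (G / L ^ (2 * (J₀ + i)) + 1 / L ^ (4 * (J₀ + i)))
        ≤ R * (κ * (3 / 2 : ℝ) ^ (J₀ + i)) * W * (G / L ^ (2 * (J₀ + i)) + 1 / L ^ (4 * (J₀ + i))) := h1
      _ = R * κ * W * ((3 / 2 : ℝ) ^ (J₀ + i) * (G / L ^ (2 * (J₀ + i)) + 1 / L ^ (4 * (J₀ + i)))) := by ring
      _ ≤ R * κ * W * (S * (1 / 4 : ℝ) ^ i) := mul_le_mul_of_nonneg_left h2 (by positivity)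
      _ = R * κ * W * S * (1 / 4 : ℝ) ^ i := by ring
  calc ∑ i ∈ Finset.range n, R * (κ * (3 / 2 : ℝ) ^ (J₀ + i) - 1) * W * (G / L ^ (2 * (J₀ + i)) + 1 / L ^ (4 * (J₀ + i)))
      ≤ ∑ i ∈ Finset.range n, R * κ * W * S * (1 / 4 : ℝ) ^ i := Finset.sum_le_sum fun i _ => hterm i
    _ = R * κ * W * S * ∑ i ∈ Finset.range n, (1 / 4 : ℝ) ^ i := by rw [Finset.mul_sum]
    _ ≤ R * κ * W * S * (4 / 3) :=
        mul_le_mul_of_nonneg_left (geom_sum_quarter _ (by norm_num) (le_refl _) n) (by positivity)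
    _ = 4 / 3 * R * κ * W * S := by ring

/-! ## §2 The registered stub -/

/-- **REGISTERED STUB `stub_telescopedCruxR` OF THE RE-GLUE SKELETON v8 (item stmt-QuantumFields-27545)**: the repaired crux `CutoffRenyiLR`
telescoped up the cut-offs of a refined family `F.refine d` with the geometric orders `q_J = κ(3/2)^J` (`κ ≤ Q`, `κ(3/2)^(J₀) ≥ 6`), given
interior masses `≥ 1/2` on `[J₀, J]`: the unit-event mass at cut-off `J` is at most
`exp((4/3)R₀κp(g_d)⁴L^(3(m+d))(γ_d²(3/2)^(J₀)/L^(2J₀) + (3/2)^(J₀)/L^(4J₀)))·(u_(J₀)/P_(J₀))^(1/2)`.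
[cite: Balaban1985UV3, (7) p.257 and (71) p.273; King1986, Thm 3.4 p.334] -/
theorem stub_telescopedCruxR :
    Summit.QuantumFields.YangMills.Theses.RenyiTelescope.CutoffRenyiLR →
    (∀ (u P q D : ℕ → ℝ) (J₀ n : ℕ),
      (∀ J, J₀ ≤ J → J ≤ J₀ + n → 0 ≤ u J ∧ 0 < P J ∧ u J ≤ P J) →
      (∀ J, J₀ ≤ J → J < J₀ + n → 1 < q J ∧ 0 ≤ D J ∧
        u (J + 1) * P J ^ (1 - 1 / q J) ≤ Real.exp (D J) * u J ^ (1 - 1 / q J) * P (J + 1)) →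
      P (J₀ + n) ≤ 1 → ∑ i ∈ Finset.range n, 1 / q (J₀ + i) ≤ 1 / 2 →
      u (J₀ + n) ≤ Real.exp (∑ i ∈ Finset.range n, D (J₀ + i)) * (u J₀ / P J₀) ^ (1 / 2 : ℝ)) →
    ∀ (L : ℕ), ∃ (c b₁ p₁ : ℝ), 0 < c ∧ c ≤ 1 ∧ ∀ (b₀ p₀ : ℝ), b₁ ≤ b₀ → p₁ ≤ p₀ → 0 < b₀ → 2 < p₀ →
      ∃ (γ₁ Q R₀ : ℝ), 0 < γ₁ ∧ γ₁ ≤ 1 ∧ 0 < Q ∧ 0 ≤ R₀ ∧ ∀ (F : T3Family) (γ : ℝ), F.L = L → 0 < γ → γ ≤ γ₁ →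
        ∀ (d J₀ J : ℕ) (κ : ℝ) (p : Plaq ((F.refine d).P 0) 0), 1 ≤ J₀ → J₀ < J → 0 < κ → κ ≤ Q →
          6 ≤ κ * (3 / 2 : ℝ) ^ J₀ →
          (∀ J', J₀ ≤ J' → J' ≤ J → 1 / 2 ≤ (gibbsK (F.refine d) ℰp (γ * ((F.L : ℝ)⁻¹) ^ d) J').real
              (histGoodInt (F.refine d) (θBal F.L (γ * ((F.L : ℝ)⁻¹) ^ d) b₀ p₀) (θBal F.L (γ * ((F.L : ℝ)⁻¹) ^ d) (c * b₀) p₀ 1) J' 1)) →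
          (gibbsK (F.refine d) ℰp (γ * ((F.L : ℝ)⁻¹) ^ d) J).real
              ((unitA (F.refine d) ℰp J) ⁻¹'
                {V | θBal F.L (γ * ((F.L : ℝ)⁻¹) ^ d) (c * b₀) p₀ 0 ≤ GaugeGroup.dist1 (GaugeField.plaqHol V p)} ∩
              histGoodInt (F.refine d) (θBal F.L (γ * ((F.L : ℝ)⁻¹) ^ d) b₀ p₀) (θBal F.L (γ * ((F.L : ℝ)⁻¹) ^ d) (c * b₀) p₀ 1) J 1) ≤
            Real.exp (4 / 3 * R₀ * κ * (B10.pFun b₀ p₀ (Real.sqrt (γ * ((F.L : ℝ)⁻¹) ^ d))) ^ 4 * (F.L : ℝ) ^ (3 * (F.m + d)) *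
                ((γ * ((F.L : ℝ)⁻¹) ^ d) ^ 2 * (3 / 2 : ℝ) ^ J₀ / (F.L : ℝ) ^ (2 * J₀) + (3 / 2 : ℝ) ^ J₀ / (F.L : ℝ) ^ (4 * J₀))) *
              ((gibbsK (F.refine d) ℰp (γ * ((F.L : ℝ)⁻¹) ^ d) J₀).real
                  ((unitA (F.refine d) ℰp J₀) ⁻¹'
                {V | θBal F.L (γ * ((F.L : ℝ)⁻¹) ^ d) (c * b₀) p₀ 0 ≤ GaugeGroup.dist1 (GaugeField.plaqHol V p)} ∩
              histGoodInt (F.refine d) (θBal F.L (γ * ((F.L : ℝ)⁻¹) ^ d) b₀ p₀) (θBal F.L (γ * ((F.L : ℝ)⁻¹) ^ d) (c * b₀) p₀ 1) J₀ 1) /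
                (gibbsK (F.refine d) ℰp (γ * ((F.L : ℝ)⁻¹) ^ d) J₀).real
                  (histGoodInt (F.refine d) (θBal F.L (γ * ((F.L : ℝ)⁻¹) ^ d) b₀ p₀) (θBal F.L (γ * ((F.L : ℝ)⁻¹) ^ d) (c * b₀) p₀ 1) J₀ 1)) ^ (1 / 2 : ℝ) := by
  intro hC hT L
  obtain ⟨c, b₁, p₁, hc, hc1, hC1⟩ := hC L
  refine ⟨c, b₁, p₁, hc, hc1, fun b₀ p₀ hb hp hb₀ hp₀ => ?_⟩
  obtain ⟨γ₁, Q, R₀, hγ₁, hγ₁1, hQ, hC2⟩ := hC1 b₀ p₀ hb hp hb₀ hp₀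
  refine ⟨γ₁, Q, max R₀ 0, hγ₁, hγ₁1, hQ, le_max_right _ _, ?_⟩
  intro F γ hFL hγ hγle d J₀ J κ p hJ₀ hJ₀J hκ hκQ hκ6 hpos
  subst hFL
  -- the refined family `F.refine d` at `γ_d = γL^(-d) ≤ γ ≤ γ₁`; `L ≥ 3` (odd, `> 1`)
  have hL3 : (3 : ℝ) ≤ F.L := by
    exact_mod_cast (show 3 ≤ F.L by obtain ⟨⟨r, hr⟩, h1⟩ := F.hL; omega)
  have hL1 : (1 : ℝ) ≤ F.L := by linarith
  have hLinv : ((F.L : ℝ)⁻¹) ^ d ≤ 1 := pow_le_one₀ (inv_nonneg.mpr (by positivity)) (inv_le_one_of_one_le₀ hL1)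
  have hγ' : 0 < γ * ((F.L : ℝ)⁻¹) ^ d := mul_pos hγ (pow_pos (inv_pos.mpr (by positivity)) _)
  have hγ'le : γ * ((F.L : ℝ)⁻¹) ^ d ≤ γ₁ := (mul_le_of_le_one_right hγ.le hLinv).trans hγle
  have hA : MeasurableSet {V : GaugeField ((F.refine d).P 0) 0 (Matrix.specialUnitaryGroup (Fin 2) ℂ) |
      θBal F.L (γ * ((F.L : ℝ)⁻¹) ^ d) (c * b₀) p₀ 0 ≤ GaugeGroup.dist1 (GaugeField.plaqHol V p)} :=
    measurableSet_le measurable_const (RegularGaugeGroup.measurable_dist1.comp (Missing.measurable_plaqHol p))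
  have h32 : (1 : ℝ) ≤ 3 / 2 := by norm_num
  have hq1 : ∀ J', J₀ ≤ J' → 1 < κ * (3 / 2 : ℝ) ^ J' := by
    intro J' hJ'
    have : κ * (3 / 2 : ℝ) ^ J₀ ≤ κ * (3 / 2 : ℝ) ^ J' :=
      mul_le_mul_of_nonneg_left (pow_le_pow_right₀ h32 hJ') hκ.le
    linarith
  -- admissibility of the orders: `κ(3/2)^J' ≤ Q·L^J'`
  have hqQ : ∀ J' : ℕ, κ * (3 / 2 : ℝ) ^ J' ≤ Q * (F.L : ℝ) ^ J' := fun J' =>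
    mul_le_mul hκQ (pow_le_pow_left₀ (by norm_num) (by linarith) J') (by positivity) hQ.le
  obtain ⟨n, rfl⟩ : ∃ n, J = J₀ + n := ⟨J - J₀, by omega⟩
  -- the telescope with `u_J, P_J, q_J = κ(3/2)^J, D_J = max(R₀,0)(q_J − 1)p⁴L^(3(m+d))(γ_d²/L^(2J) + 1/L^(4J))`
  have key := hT
    (fun J' => (gibbsK (F.refine d) ℰp (γ * ((F.L : ℝ)⁻¹) ^ d) J').real ((unitA (F.refine d) ℰp J') ⁻¹'
                {V | θBal F.L (γ * ((F.L : ℝ)⁻¹) ^ d) (c * b₀) p₀ 0 ≤ GaugeGroup.dist1 (GaugeField.plaqHol V p)} ∩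
              histGoodInt (F.refine d) (θBal F.L (γ * ((F.L : ℝ)⁻¹) ^ d) b₀ p₀) (θBal F.L (γ * ((F.L : ℝ)⁻¹) ^ d) (c * b₀) p₀ 1) J' 1))
    (fun J' => (gibbsK (F.refine d) ℰp (γ * ((F.L : ℝ)⁻¹) ^ d) J').real (histGoodInt (F.refine d) (θBal F.L (γ * ((F.L : ℝ)⁻¹) ^ d) b₀ p₀) (θBal F.L (γ * ((F.L : ℝ)⁻¹) ^ d) (c * b₀) p₀ 1) J' 1))
    (fun J' => κ * (3 / 2 : ℝ) ^ J')
    (fun J' => max R₀ 0 * (κ * (3 / 2 : ℝ) ^ J' - 1) * ((B10.pFun b₀ p₀ (Real.sqrt (γ * ((F.L : ℝ)⁻¹) ^ d))) ^ 4 *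
      (F.L : ℝ) ^ (3 * (F.m + d))) * ((γ * ((F.L : ℝ)⁻¹) ^ d) ^ 2 / (F.L : ℝ) ^ (2 * J') + 1 / (F.L : ℝ) ^ (4 * J')))
    J₀ n ?_ ?_ ?_ (order_budgetR hκ hκ6 n)
  · -- conclusion: bound the summed exponent
    refine key.trans (mul_le_mul_of_nonneg_right (Real.exp_le_exp.mpr ?_) (Real.rpow_nonneg (div_nonneg measureReal_nonneg
      measureReal_nonneg) _))
    refine (exponent_budgetR hL3 hκ (le_max_right _ _) (by positivity) (by positivity) J₀ n).trans (le_of_eq ?_)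
    ring
  · -- masses: `0 ≤ u ≤ P`, `0 < P` (interior masses ≥ 1/2)
    intro J' h1 h2
    haveI := isProbabilityMeasure_gibbsK (F.refine d) ℰp hγ'.le J'
    exact ⟨measureReal_nonneg, lt_of_lt_of_le (by norm_num) (hpos J' h1 h2),
      measureReal_mono Set.inter_subset_right (measure_ne_top _ _)⟩
  · -- the one-step inequality = the repaired crux `CutoffRenyiLR` for `F.refine d` at order `q_J`
    intro J' h1 h2
    have hq := hq1 J' h1
    have hqm : 0 ≤ κ * (3 / 2 : ℝ) ^ J' - 1 := by linarith
    have hD0 : 0 ≤ max R₀ 0 * (κ * (3 / 2 : ℝ) ^ J' - 1) * ((B10.pFun b₀ p₀ (Real.sqrt (γ * ((F.L : ℝ)⁻¹) ^ d))) ^ 4 *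
        (F.L : ℝ) ^ (3 * (F.m + d))) * ((γ * ((F.L : ℝ)⁻¹) ^ d) ^ 2 / (F.L : ℝ) ^ (2 * J') + 1 / (F.L : ℝ) ^ (4 * J')) := by positivity
    refine ⟨hq, hD0, ?_⟩
    have h27 := hC2 (F.refine d) (γ * ((F.L : ℝ)⁻¹) ^ d) rfl hγ' hγ'le J' (κ * (3 / 2 : ℝ) ^ J') (le_trans hJ₀ h1) hq (hqQ J') _ hA
    refine h27.trans (mul_le_mul_of_nonneg_right (mul_le_mul_of_nonneg_right (Real.exp_le_exp.mpr ?_)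
      (Real.rpow_nonneg measureReal_nonneg _)) measureReal_nonneg)
    have hW : 0 ≤ (κ * (3 / 2 : ℝ) ^ J' - 1) * ((B10.pFun b₀ p₀ (Real.sqrt (γ * ((F.L : ℝ)⁻¹) ^ d))) ^ 4 *
        (F.L : ℝ) ^ (3 * (F.m + d))) * ((γ * ((F.L : ℝ)⁻¹) ^ d) ^ 2 / (F.L : ℝ) ^ (2 * J') + 1 / (F.L : ℝ) ^ (4 * J')) := by positivity
    calc R₀ * (κ * (3 / 2 : ℝ) ^ J' - 1) * (B10.pFun b₀ p₀ (Real.sqrt (γ * ((F.L : ℝ)⁻¹) ^ d))) ^ 4 *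
          ((F.refine d).L : ℝ) ^ (3 * (F.refine d).m) *
          ((γ * ((F.L : ℝ)⁻¹) ^ d) ^ 2 / ((F.refine d).L : ℝ) ^ (2 * J') + 1 / ((F.refine d).L : ℝ) ^ (4 * J'))
        = R₀ * ((κ * (3 / 2 : ℝ) ^ J' - 1) * ((B10.pFun b₀ p₀ (Real.sqrt (γ * ((F.L : ℝ)⁻¹) ^ d))) ^ 4 *
          (F.L : ℝ) ^ (3 * (F.m + d))) * ((γ * ((F.L : ℝ)⁻¹) ^ d) ^ 2 / (F.L : ℝ) ^ (2 * J') + 1 / (F.L : ℝ) ^ (4 * J'))) := by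
          rw [T3Family.refine_m, T3Family.refine_L]; ring
      _ ≤ max R₀ 0 * ((κ * (3 / 2 : ℝ) ^ J' - 1) * ((B10.pFun b₀ p₀ (Real.sqrt (γ * ((F.L : ℝ)⁻¹) ^ d))) ^ 4 *
          (F.L : ℝ) ^ (3 * (F.m + d))) * ((γ * ((F.L : ℝ)⁻¹) ^ d) ^ 2 / (F.L : ℝ) ^ (2 * J') + 1 / (F.L : ℝ) ^ (4 * J'))) :=
          mul_le_mul_of_nonneg_right (le_max_left _ _) hW
      _ = max R₀ 0 * (κ * (3 / 2 : ℝ) ^ J' - 1) * ((B10.pFun b₀ p₀ (Real.sqrt (γ * ((F.L : ℝ)⁻¹) ^ d))) ^ 4 *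
          (F.L : ℝ) ^ (3 * (F.m + d))) * ((γ * ((F.L : ℝ)⁻¹) ^ d) ^ 2 / (F.L : ℝ) ^ (2 * J') + 1 / (F.L : ℝ) ^ (4 * J')) := by ring
  · -- `P ≤ 1`
    haveI := isProbabilityMeasure_gibbsK (F.refine d) ℰp hγ'.le (J₀ + n)
    exact measureReal_le_one

end Summit.QuantumFields.YangMills.Theorems.RenyiTelescope

end
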